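import Literature.NumberTheory.LFunctions.RodgersTaoWeakEnergyLocationProofs
import Literature.NumberTheory.LFunctions.RodgersTaoRiemannVonMangoldtProofs
import HarnessLib

/-!
# Rodgers–Tao 2020, proof of Proposition 15 (FMP pp. 38–39): location-law extras for the S4
assembly (rt-t4's W-list) — stage S3⁺ of the P6.1 content twin

RH-FREE literature PROOFS (no definitions, no named facts). Trunk T-ANT
(`Literature/NumberTheory/LFunctions`); the three items of rt-t4's S4 wish-list (rt/STATUS
2026-08-26T11:43:30Z, ruling (55)(d)) not already in `RodgersTaoWeakEnergyLocationProofs.lean`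
(S3, p442465), for the assembly of the content twin of `rodgers_tao_weak_energy_bound`
(B. Rodgers, T. Tao, *The de Bruijn–Newman constant is non-negative*, Forum Math. Pi 8 (2020) e6,
Proposition 15, proof FMP pp. 38–39 = arXiv:1801.05914v5 l.950–977):

* (W1) the two-tolerance perturbation `(ξ_j − ξ_k) − (E_j + E_k) ≤ x_j − x_k` (location law (50)
  with index-dependent error `E_j = B log₊ ξ_j`);
* (W2) the packaged per-`k` ENERGY far sum `Σ_{j ∈ S} (x_j − x_k)^{−2} ≤ 16/(g² L)` over indices
  `j` of a block at index distance `≥ L` from `k` (`4E ≤ gL`), in rt-t4's verbatim shape — the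
  «FAR» piece of the repaired Cauchy–Schwarz step (ERRATA E13) of FMP p. 39;
* (W3) the mean-value lower bound for general index gaps of the classical locations,
  `4π(y′ − y)/log(ξ_{y′}/4π) ≤ ξ_{y′} − ξ_y` (`1 ≤ y ≤ y′`), from `RodgersTao2020.exists_mvt_classicalLocation`
  (FMP Lemma 8, proof) — gives the spacing constant `g = 4π/log(ξ_b/4π)` on any block `[a, b]`.

LABEL: RH-FREE CONTENT (0 facts). bears_on: N-C/N-P (COLUMN 3 DBN).
WHAT THIS IS NOT: bookkeeping for Rodgers–Tao's RH-free integrated-energy bound (VACUOUS-AS-PRINTED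
on `[Λ/2, 0]`); nothing here bears on the truth of RH.
-/

noncomputable section

open Real Set Finset

namespace Literature.NumberTheory.LFunctions

/-! ## (W1) Two-tolerance perturbation -/

/-- `|x_j − ξ_j| ≤ E_j`, `|x_k − ξ_k| ≤ E_k` ⇒ `(ξ_j − ξ_k) − (E_j + E_k) ≤ x_j − x_k`.
[cite: RodgersTaoFMP2020, §6 proof of Prop. 15, FMP pp. 38–39 (uses of eq. (50) = arXiv (add))] -/
theorem sub_sub_add_le_sub_of_location {xj xk ξj ξk Ej Ek : ℝ} (hj : |xj - ξj| ≤ Ej)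
    (hk : |xk - ξk| ≤ Ek) : (ξj - ξk) - (Ej + Ek) ≤ xj - xk := by
  have h1 := (abs_le.1 hj).1
  have h2 := (abs_le.1 hk).2
  linarith

/-- `|x_j − ξ_j| ≤ E_j`, `|x_k − ξ_k| ≤ E_k` ⇒ `x_j − x_k ≤ (ξ_j − ξ_k) + (E_j + E_k)`.
[cite: RodgersTaoFMP2020, §6 proof of Prop. 15, FMP pp. 38–39 (uses of eq. (50) = arXiv (add))] -/
theorem sub_le_sub_add_add_of_location {xj xk ξj ξk Ej Ek : ℝ} (hj : |xj - ξj| ≤ Ej)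
    (hk : |xk - ξk| ≤ Ek) : xj - xk ≤ (ξj - ξk) + (Ej + Ek) := by
  have h1 := (abs_le.1 hj).2
  have h2 := (abs_le.1 hk).1
  linarith

/-- `|x_j − ξ_j| ≤ E_j`, `|x_k − ξ_k| ≤ E_k` ⇒ `|ξ_j − ξ_k| − (E_j + E_k) ≤ |x_j − x_k|`.
[cite: RodgersTaoFMP2020, §6 proof of Prop. 15, FMP pp. 38–39 (uses of eq. (50) = arXiv (add))] -/
theorem abs_sub_sub_add_le_abs_sub_of_location {xj xk ξj ξk Ej Ek : ℝ} (hj : |xj - ξj| ≤ Ej)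
    (hk : |xk - ξk| ≤ Ek) : |ξj - ξk| - (Ej + Ek) ≤ |xj - xk| := by
  have h1 := sub_sub_add_le_sub_of_location hj hk
  have h2 := sub_le_sub_add_add_of_location hj hk
  rcases le_total 0 (ξj - ξk) with h | h
  · rw [abs_of_nonneg h]
    have : xj - xk ≤ |xj - xk| := le_abs_self _
    linarith
  · rw [abs_of_nonpos h]
    have : xk - xj ≤ |xj - xk| := by rw [abs_sub_comm]; exact le_abs_self _
    linarith

/-! ## (W2) The per-`k` energy far sum -/

/-- **Per-`k` energy far sum** (rt-t4's S4 shape; the «FAR» piece of the repaired Cauchy–Schwarz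
step of FMP p. 39): on a block `a ≤ · ≤ b` with `|x n − ξ n| ≤ E` and `ξ`-gaps `≥ g > 0`, for
`k` in the block and indices `j` of the block at index distance `≥ L` from `k`, where
`4E ≤ gL` and `L ≥ 1`: `Σ_{j∈S} (x_j − x_k)^{−2} ≤ 16/(g² L)` (`|x_j − x_k| ≥ g|j − k|/2` and
`Σ_{|n| ≥ L} n^{−2} ≤ 4/L`).
[cite: RodgersTaoFMP2020, §6 proof of Prop. 15, FMP p. 39 (uses of eq. (50) = arXiv (add))] -/
theorem sum_inv_sq_sub_le_of_far {x ξ : ℕ → ℝ} {a b L : ℕ} {E g : ℝ} (hg : 0 < g)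
    (hloc : ∀ n, a ≤ n → n ≤ b → |x n - ξ n| ≤ E)
    (hgap : ∀ n, a ≤ n → n < b → g ≤ ξ (n + 1) - ξ n) (hL : 4 * E ≤ g * L) (hL1 : 1 ≤ L)
    {k : ℕ} (hka : a ≤ k) (hkb : k ≤ b) (S : Finset ℕ)
    (hS : ∀ j ∈ S, a ≤ j ∧ j ≤ b ∧ L ≤ ((j : ℤ) - k).natAbs) :
    ∑ j ∈ S, ((x j - x k) ^ 2)⁻¹ ≤ 16 / (g ^ 2 * L) := by
  -- index distance of `j ∈ S` from `k`, as an integer and as a real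
  have hdistZ : ∀ j ∈ S, (L : ℤ) ≤ |(k : ℤ) - j| := by
    intro j hj
    have h := (hS j hj).2.2
    rw [abs_sub_comm, Int.abs_eq_natAbs]
    exact_mod_cast h
  have hdistR : ∀ j ∈ S, (L : ℝ) ≤ |(j : ℝ) - k| := by
    intro j hj
    have h := hdistZ j hj
    rw [abs_sub_comm] at h
    have : ((L : ℤ) : ℝ) ≤ ((|(j : ℤ) - k| : ℤ) : ℝ) := by exact_mod_cast h
    simpa [Int.cast_abs, Int.cast_sub] using this
  have hL0 : (0 : ℝ) < L := by exact_mod_cast hL1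
  -- `g |j − k| / 2 ≤ |x j − x k|` on `S`
  have hfar : ∀ j ∈ S, g / 2 * |(j : ℝ) - k| ≤ |x j - x k| := by
    intro j hj
    obtain ⟨hja, hjb, -⟩ := hS j hj
    have h4 : 4 * E ≤ g * |(j : ℝ) - k| :=
      hL.trans (mul_le_mul_of_nonneg_left (hdistR j hj) hg.le)
    have := half_mul_dist_le_abs_sub_of_location hgap hloc hja hjb hka hkb h4
    linarith
  have hpos : ∀ j ∈ S, 0 < |(j : ℝ) - k| := fun j hj ↦ hL0.trans_le (hdistR j hj)
  -- compare with the index sum and use the numeric tail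
  have h1 : ∑ j ∈ S, ((x j - x k) ^ 2)⁻¹ = ∑ j ∈ S, (|x j - x k| ^ 2)⁻¹ :=
    Finset.sum_congr rfl fun j _ ↦ by rw [sq_abs]
  have h2 := sum_inv_sq_le_of_mul_le S (a := fun j ↦ |x j - x k|) (d := fun j ↦ |(j : ℝ) - k|)
    (c := g / 2) (by positivity) hfar hpos
  have h3 : ∑ j ∈ S, (|(j : ℝ) - k| ^ 2)⁻¹ ≤ 4 / L := by
    have h := sum_inv_dist_sq_le S k hL1 hdistZ
    refine le_trans (le_of_eq (Finset.sum_congr rfl fun j _ ↦ ?_)) h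
    rw [abs_sub_comm]
  rw [h1]
  calc ∑ j ∈ S, (|x j - x k| ^ 2)⁻¹ ≤ ((g / 2) ^ 2)⁻¹ * ∑ j ∈ S, (|(j : ℝ) - k| ^ 2)⁻¹ := h2
    _ ≤ ((g / 2) ^ 2)⁻¹ * (4 / L) := mul_le_mul_of_nonneg_left h3 (by positivity)
    _ = 16 / (g ^ 2 * L) := by field_simp; ring

/-! ## (W3) Mean-value lower bound for general index gaps of `ξ` -/

/-- **General-gap lower bound for the classical locations**: for `1 ≤ y ≤ y′`,
`4π(y′ − y)/log(ξ_{y′}/4π) ≤ ξ_{y′} − ξ_y` (mean value theorem `ξ_{y′} − ξ_y = 4π(y′−y)/log(θ/4π)`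
with `θ < ξ_{y′}`; gives the spacing constant `g = 4π/log(ξ_b/4π)` on any block `[a, b]`).
[cite: RodgersTaoFMP2020, Lemma 8 (proof), §3 (arXiv v5 Lemma 3.1); §6 proof of Prop. 15] -/
theorem four_pi_mul_sub_div_log_le_classicalLocation_sub {y y' : ℝ} (hy : 1 ≤ y) (hyy' : y ≤ y') :
    4 * π * (y' - y) / Real.log (classicalLocation y' / (4 * π)) ≤
      classicalLocation y' - classicalLocation y := by
  rcases eq_or_lt_of_le hyy' with rfl | hlt
  · simp
  have hy1 : -1 ≤ y := by linarith
  obtain ⟨θ, hθ1, hθ2, hlog, h⟩ := RodgersTao2020.exists_mvt_classicalLocation hy1 hlt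
  have hπ : 0 < 4 * π := by positivity
  have hθ0 : 0 < θ := lt_trans (lt_of_lt_of_le hπ (four_pi_le_classicalLocation hy1)) hθ1
  rw [h]
  refine div_le_div_of_nonneg_left (by nlinarith [Real.pi_pos]) hlog ?_
  exact Real.log_le_log (div_pos hθ0 hπ) (div_le_div_of_nonneg_right hθ2.le hπ.le)

end Literature.NumberTheory.LFunctions

end
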